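import Mathlib
import HarnessLib
import Summits.ValiantsHypothesis.ValiantsHypothesis.Theses.MonotoneRestoration
import Literature.Computability.AlgebraicComplexity.ArithCircuit
import Literature.Computability.AlgebraicComplexity.SymmetricArithCircuit
import Literature.Computability.AlgebraicComplexity.MonotoneStructure
import Summits.ValiantsHypothesis.ValiantsHypothesis.Theorems.MonotoneRestorationMonotoneRestorationQPChooseLeCard
import Summits.ValiantsHypothesis.ValiantsHypothesis.Theorems.MonotoneRestorationMonotoneRestorationQPEsymmRowSumsStructure
import Summits.ValiantsHypothesis.ValiantsHypothesis.Theorems.MonotoneRestorationMonotoneRestorationQPEsymmRowSumsComplexity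
import Summits.ValiantsHypothesis.ValiantsHypothesis.Theorems.MonotoneRestorationMonotoneRestorationQPGammaArithmetic

/-!
# THEOREM γ, corollary — the CANCELLATION-FREE strengthening of `MonotoneRestorationQP` is FALSE

Support file (`--supports stmt-ValiantsHypothesis-15886`) of line `Sketch`, lead c2 (cycle 2):
assembly of the side stubs G1–G6 of the registered skeleton (`Cruxes/…/Lines/Sketch.lean`).

The crux `MonotoneRestorationQP` promises, for every matrix-symmetric monotone-easy family over
`ℝ≥0`, quasi-polynomial square-symmetric circuits OVER `ℂ`. The strategist's census (§S3,
`Cruxes/MonotoneRestorationQP/StrategyCensus.lean`, `MonotoneSymmetricRestorationQP`) typed the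
natural strengthening in which the symmetric circuit is itself CANCELLATION-FREE (a symmetric
`LabelledArithCircuit` over the semiring `ℝ≥0` computing `f n`), with a paper disproof. This file
lands the disproof (statement inlined verbatim, no new definitions):

* `not_monotoneSymmetricRestorationQP` — the strengthening fails at
  `E_n = e_{⌊n/2⌋}(R₁,…,R_n)`, `R_i = Σ_j x_ij`: matrix-symmetric and of monotone complexity
  `≤ (n+2)^{c₀}` (G4b `stub_esymmRowSums_structure`, G4 `stub_esymmRowSums_complexity`), while by
  THEOREM γ (G6 `stub_symmetricMonotone_choose_le_card`, support accumulation along a monotone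
  spine: G1 support theorem in gate-stabiliser form, G2 `Alt`-orbit dichotomy, G3 no-cancellation
  at `×` gates) every `Sym_n`-symmetric circuit over `ℝ≥0` computing it has at least
  `C(n, k) > 2^{(log₂ n + c)^c}` gates for `k = (log₂ n + c)^c + 2` and `n` large (G5
  `stub_gammaArithmetic`).
* The linear-degree form of γ (invested seat xfam-a, `…QPGammaChooseLeCard.lean`,
  `esymmRowSums_half_symmetricMonotone_choose_le_card`) gives `≥ C(n, ⌊n/6⌋) = 2^{Ω(n)}` gates.

Consequence for the crux (census): every restoration of this family — it HAS polynomial-size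
square-symmetric circuits over `ℂ` (Newton / interpolation in the row power sums) — must use
negative constants; no proof of `MonotoneRestorationQP` can be an induction that stays inside
`ℝ≥0`, and the signed constants must enter exactly where homogeneous components / orbit
products are extracted.
-/

-- `ValiantsHypothesis.ValiantsHypothesis`: the D-0017 layout repeats the problem name in the path.
set_option linter.dupNamespace false

namespace Summit.ValiantsHypothesis.ValiantsHypothesis.Theorems

open Literature.Computability.AlgebraicComplexity

/-- **COROLLARY γ — the cancellation-free strengthening of the crux is FALSE.** It is not the
case that every matrix-symmetric family over `ℝ≥0` of polynomial degree and polynomial monotone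
complexity has quasi-polynomial-size `Sym_n`-symmetric circuits OVER `ℝ≥0` (statement =
`StrategyCensus.MonotoneSymmetricRestorationQP`, inlined): the family `e_{⌊n/2⌋}` of the row sums
is matrix-symmetric (G4b) and monotone-easy (G4), but for the exponent `c` that the strengthening
would provide, at a large `n` (G5) the promised circuit of size `≤ 2^{(log₂ n + c)^c}` would have
fewer than `C(n, (log₂ n + c)^c + 2)` gates, contradicting Theorem γ (G6). [new] -/
theorem not_monotoneSymmetricRestorationQP :
    ¬ (∀ f : (n : ℕ) → MvPolynomial (Fin n × Fin n) NNReal,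
      (∀ (n : ℕ) (σ τ : Equiv.Perm (Fin n)),
        MvPolynomial.rename (fun p : Fin n × Fin n => (σ p.1, τ p.2)) (f n) = f n) →
      (∃ c : ℕ, ∀ n : ℕ, (f n).totalDegree ≤ (n + 2) ^ c ∧
        complexity (k := NNReal) (f n) ≤ (n + 2) ^ c) →
      ∃ c : ℕ, ∀ n : ℕ, ∃ (G : Type) (_ : Fintype G)
        (C : LabelledArithCircuit NNReal (Fin n × Fin n) Unit G),
        C.IsSymmetric (Equiv.Perm (Fin n)) ∧ C.eval (C.output ()) = f n ∧
          Fintype.card G ≤ 2 ^ ((Nat.log 2 n + c) ^ c)) := by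
  intro h
  obtain ⟨c₀, hc₀⟩ := stub_esymmRowSums_complexity
  have hpoly : ∃ c : ℕ, ∀ n : ℕ,
      (MvPolynomial.bind₁ (fun i : Fin n => ∑ j : Fin n, MvPolynomial.X (i, j))
          (MvPolynomial.esymm (Fin n) NNReal (n / 2))).totalDegree ≤ (n + 2) ^ c ∧
        complexity (k := NNReal) (MvPolynomial.bind₁
          (fun i : Fin n => ∑ j : Fin n, MvPolynomial.X (i, j))
          (MvPolynomial.esymm (Fin n) NNReal (n / 2))) ≤ (n + 2) ^ c := by
    refine ⟨c₀ + 1, fun n => ⟨?_, ?_⟩⟩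
    · calc (MvPolynomial.bind₁ (fun i : Fin n => ∑ j : Fin n, MvPolynomial.X (i, j))
              (MvPolynomial.esymm (Fin n) NNReal (n / 2))).totalDegree ≤ n / 2 :=
            (stub_esymmRowSums_structure n).1.totalDegree_le
        _ ≤ n + 2 := by omega
        _ ≤ (n + 2) ^ (c₀ + 1) := by
            calc n + 2 = (n + 2) ^ 1 := (pow_one _).symm
              _ ≤ (n + 2) ^ (c₀ + 1) := Nat.pow_le_pow_right (by omega) (by omega)
    · exact (hc₀ n).trans (Nat.pow_le_pow_right (by omega) (by omega))
  obtain ⟨c, hc⟩ := h (fun n => MvPolynomial.bind₁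
      (fun i : Fin n => ∑ j : Fin n, MvPolynomial.X (i, j))
      (MvPolynomial.esymm (Fin n) NNReal (n / 2)))
    (fun n σ τ => (stub_esymmRowSums_structure n).2.2.2 σ τ) hpoly
  obtain ⟨N, hN⟩ := stub_gammaArithmetic c
  obtain ⟨h8, h4k, hkk, hdk, hchoose⟩ := hN N le_rfl
  obtain ⟨G, hG, C, hsym, heval, hcard⟩ := hc N
  obtain ⟨hhom, hrow, h0, -⟩ := stub_esymmRowSums_structure N
  rw [← heval] at hhom hrow h0
  have hle := stub_symmetricMonotone_choose_le_card C hsym hhom h0 hrow h8 (by omega) h4k hkk hdk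
  exact absurd (hle.trans hcard) (not_le.2 hchoose)

end Summit.ValiantsHypothesis.ValiantsHypothesis.Theorems
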